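/-
Copyright (c) 2026 the pub-hodgecm-mathlib formalisation cell (harness21).  R90-TF SLAB, section S10 (Rogawski 1990, Ch. 13.8 read at `v`), prover R90-C138-p04 (g2) —
DEAL #86 (dealer R90-C138-plan (g4), 2026-09-05): the S8 → S10 read-back of FILE D's block (D2-θ) `ThetaGPinnedHyp` (body currency; Theorems cannot import `Lines`);
h413 = `stmt-HodgeConjecture-24833`, route `HCCMUnconditional`.
-/
import Summits.HodgeConjecture.HodgeConjecture.Theorems.R90S10FrozenFamilyMaps       -- ★ W1-H3: `S10Frozen.ΦGu`, `UnrQs` (+ ★ C2 carriers `G3`, `Gqs`, `HLoc`, E1 `discreteSumG`)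
import Literature.NumberTheory.Rogawski1990.StabilisationIdentities                  -- ★ `StabilisationData` (`θG`, …)
import HarnessLib

/-!
# R90-TF ∕ S10 — THE S8 → S10 READ-BACK OF `Θ_G` PINNED TO ITS DISCRETE PART ON THE FROZEN FAMILY (`Theorems/R90S10ThetaOfThetaGPinned.lean`; ns `Summit.HodgeConjecture.HodgeConjecture.R90.S10`)

Cell `hodgecm-mathlib`, crux H413 (`stmt-HodgeConjecture-24833`), route of record `HCCMUnconditional`; programme R90-TF, section S10 (base `R90-C138`).  PROOF lane
(`--kind proof --supports stmt-HodgeConjecture-24833 --as helper`): theorems only; no `def`, no instance, no notation, no `sorry`; imports ★ only — a `Theorems` file cannot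
import `Cruxes/…/Lines`, so FILE D's block (D2-θ)
  `ThetaGPinnedHyp L v 𝔖 ΦGu dG contG := ∀ (u : Unr) (φ : Gqs L v → ℂ), 𝔖.θG (ΦGu u φ) = dG (ΦGu u φ) + contG (ΦGu u φ)`
(`Lines/R90_S10_TFDecompositionD.lean` :210, a plain `def`, so `ThetaGPinnedHyp … ↔ ‹body›` is `Iff.rfl` — certified by the by-import probe
`R90/R90-C138-p04/g2/Probe_ThetaGPinned_IffRfl.lean`) is handled here THROUGH ITS BODY, token for token.  The keystone (`R90S10StabilisedAtEvp2OfInputs*`) and D ED. 6′ bind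
it at `contG := 0`, `ΦGu := 𝔣.𝔳.ΦGu S`, `dG := fun F => discreteSumG (G3 L) μG νG (toAdelic F)` («`θ_G(f) = Σ_π m(π) Tr π(f) + Σ_χ Tr(M_G(χ) I_χ(f))`», (13.6.1), with the
intertwining term absent on the frozen family).

CONTENTS (XS glue, generic in `TG TH Unr`): §1 `thetaGPinned_zero_iff` (the `contG := 0` body ↔ `∀ u φ, θ_G(Φ u φ) = dG(Φ u φ)` — the `+ 0 f` summand erased, BOTH directions),
`thetaGPinned_zero_of_decomposition` (S8's natural supply: (13.6.1) `θ_G = dG + contG` on ALL test functions + `contG = 0` on the family ⇒ the pinned-zero body),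
`thetaGPinned_zero_of_pinned` (the same from the pinned form with a vanishing `contG`), `thetaGPinned_of_zero` (converse: the pinned-zero body gives the pinned body for
ANY `contG` vanishing on the family); §2 the instances at the frozen family of record `Φ := 𝔳.ΦGu S`, `dG := discreteSumG (G3 L) μG νG ∘ toAdelic`:
`thetaGPinned_frozen_zero_iff`, `thetaGPinned_frozen_zero_of_decomposition`.
HONEST LABEL: bookkeeping over ★ definitions; proves nothing printed; closes no socket; HC_CM is proved only modulo the 7 printed citations (2 remaining named inputs:
hLiu418 = `stmt-HodgeConjecture-24832`, h413 = `stmt-HodgeConjecture-24833`) until rung 0 closes; REL ≠ ★ ≠ BUILT; count-neutral.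

## References
* [Rogawski1990] J. D. Rogawski, *Automorphic Representations of Unitary Groups in Three Variables*, Ann. of Math. Stud. 123 (1990), §13.6 (13.6.1) p. 208; §13.8 p. 218.
* [Arthur2005IntroTraceFormula] J. Arthur, *An introduction to the trace formula*, Clay Math. Proc. 4 (2005), §7 Thm. 7.2 (the spectral decomposition `L² = ⊕_𝔓 L²_𝔓`, whence `θ_G = ` discrete `+` continuous).
-/

set_option autoImplicit false
set_option linter.dupNamespace false

noncomputable section

open scoped RestrictedProduct
open Filter MeasureTheory NumberField IsDedekindDomain CompactlySupported Topology
open Literature.NumberTheory.Rogawski1990 Literature.NumberTheory.Automorphic Literature.NumberTheory.Automorphic.UnitaryGroup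
open Literature.NumberTheory.GaloisRepresentations (HeckeCharacter)
open Summit.HodgeConjecture.HodgeConjecture.Cruxes.H413
open Summit.HodgeConjecture.HodgeConjecture.Cruxes.H413.K2E1TraceFormulaBeta
open Summit.HodgeConjecture.HodgeConjecture.Cruxes.H413.K2E1GlobalTestFunctions
open Summit.HodgeConjecture.HodgeConjecture.Cruxes.H413.K2E1SpectralTermsDiscreteHalf

namespace Summit.HodgeConjecture.HodgeConjecture.R90.S10

/-! ## §1 The body of `ThetaGPinnedHyp … dG contG` at `contG := 0`, generic -/

section Generic

variable {L : Type} [Field L] [NumberField L] [IsCMField L] {v : Pl L} {TG TH Unr : Type*}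

/-- **`ThetaGPinnedHyp … dG 0` ↔ `θ_G = dG` on the family** (the summand `(0 : TG → ℂ) f = 0` erased; both directions). [cite: Rogawski1990, §13.6 (13.6.1) p. 208] -/
theorem thetaGPinned_zero_iff (𝔖 : StabilisationData TG TH) (ΦGu : Unr → (Gqs L v → ℂ) → TG) (dG : TG → ℂ) :
    (∀ (u : Unr) (φ : Gqs L v → ℂ), 𝔖.θG (ΦGu u φ) = dG (ΦGu u φ) + (0 : TG → ℂ) (ΦGu u φ)) ↔
      ∀ (u : Unr) (φ : Gqs L v → ℂ), 𝔖.θG (ΦGu u φ) = dG (ΦGu u φ) := by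
  simp only [Pi.zero_apply, add_zero]

/-- **S8's natural supply ⇒ the pinned-zero body**: if `θ_G(f) = dG(f) + contG(f)` for EVERY test function `f` ((13.6.1): discrete sum + intertwining-operator term) and the
intertwining term VANISHES on the frozen family, then `θ_G = dG + 0` on the family. [cite: Rogawski1990, §13.6 (13.6.1) p. 208; §13.8 p. 218] [cite: Arthur2005IntroTraceFormula, §7 Thm. 7.2] -/
theorem thetaGPinned_zero_of_decomposition (𝔖 : StabilisationData TG TH) (ΦGu : Unr → (Gqs L v → ℂ) → TG) (dG contG : TG → ℂ)
    (hθ : ∀ f : TG, 𝔖.θG f = dG f + contG f) (hvan : ∀ (u : Unr) (φ : Gqs L v → ℂ), contG (ΦGu u φ) = 0) :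
    ∀ (u : Unr) (φ : Gqs L v → ℂ), 𝔖.θG (ΦGu u φ) = dG (ΦGu u φ) + (0 : TG → ℂ) (ΦGu u φ) := fun u φ => by
  rw [hθ, hvan u φ, Pi.zero_apply]

/-- **Pinned with a vanishing continuous term ⇒ pinned-zero**: `ThetaGPinnedHyp … dG contG`'s body with `contG = 0` on the family gives the `contG := 0` body.
[cite: Rogawski1990, §13.6 (13.6.1) p. 208] -/
theorem thetaGPinned_zero_of_pinned (𝔖 : StabilisationData TG TH) (ΦGu : Unr → (Gqs L v → ℂ) → TG) (dG contG : TG → ℂ)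
    (hθ : ∀ (u : Unr) (φ : Gqs L v → ℂ), 𝔖.θG (ΦGu u φ) = dG (ΦGu u φ) + contG (ΦGu u φ))
    (hvan : ∀ (u : Unr) (φ : Gqs L v → ℂ), contG (ΦGu u φ) = 0) :
    ∀ (u : Unr) (φ : Gqs L v → ℂ), 𝔖.θG (ΦGu u φ) = dG (ΦGu u φ) + (0 : TG → ℂ) (ΦGu u φ) := fun u φ => by
  rw [hθ u φ, hvan u φ, Pi.zero_apply]

/-- **Converse**: the pinned-zero body gives `ThetaGPinnedHyp … dG contG`'s body for every `contG` vanishing on the family. [cite: Rogawski1990, §13.6 (13.6.1) p. 208] -/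
theorem thetaGPinned_of_zero (𝔖 : StabilisationData TG TH) (ΦGu : Unr → (Gqs L v → ℂ) → TG) (dG contG : TG → ℂ)
    (hθ : ∀ (u : Unr) (φ : Gqs L v → ℂ), 𝔖.θG (ΦGu u φ) = dG (ΦGu u φ) + (0 : TG → ℂ) (ΦGu u φ))
    (hvan : ∀ (u : Unr) (φ : Gqs L v → ℂ), contG (ΦGu u φ) = 0) :
    ∀ (u : Unr) (φ : Gqs L v → ℂ), 𝔖.θG (ΦGu u φ) = dG (ΦGu u φ) + contG (ΦGu u φ) := fun u φ => by
  rw [hθ u φ, hvan u φ, Pi.zero_apply]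

end Generic

/-! ## §2 At the frozen family of record: `Φ := 𝔳.ΦGu S`, `dG := discreteSumG (G3 L) μG νG ∘ toAdelic`, `contG := 0` -/

section Frozen

variable {L : Type} [Field L] [NumberField L] [IsCMField L] [DecidableEq (Pl L)] {μ : HeckeCharacter L} {v : Pl L}
  [MeasurableSpace (HLoc L v)] [BorelSpace (HLoc L v)] [MeasurableSpace (Gqs L v)] [BorelSpace (Gqs L v)]
  {νHv : Measure (HLoc L v)} {νQv : Measure (Gqs L v)} [νHv.IsHaarMeasure] [νHv.IsMulRightInvariant] [νQv.IsHaarMeasure] [νQv.IsMulRightInvariant]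
  [∀ a : HLoc L v, MeasurableSpace (HLoc L v ⧸ Subgroup.centralizer ({a} : Set (HLoc L v)))]
  [∀ a : HLoc L v, BorelSpace (HLoc L v ⧸ Subgroup.centralizer ({a} : Set (HLoc L v)))]
  [∀ γ : Gqs L v, MeasurableSpace (Gqs L v ⧸ Subgroup.centralizer ({γ} : Set (Gqs L v)))]
  [∀ γ : Gqs L v, BorelSpace (Gqs L v ⧸ Subgroup.centralizer ({γ} : Set (Gqs L v)))]
  {mHv : OrbitalMeasureFamily (HLoc L v)} {mQv : OrbitalMeasureFamily (Gqs L v)} {πSt : IrrClass (HLoc L v)}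
  [MeasurableSpace (H2 L).Adelic] [BorelSpace (H2 L).Adelic]
  [MeasurableSpace (GArch L)] [BorelSpace (GArch L)] [MeasurableSpace (HArch L)] [BorelSpace (HArch L)]
  [MeasurableSpace (H1Loc L v)] [MeasurableSpace (H1Arch L)] [MeasurableSpace (H1 L).Adelic] [BorelSpace (H1 L).Adelic]
  {𝔥 : S10HDatum L μ v νHv νQv mHv mQv πSt}
  [MeasurableSpace (G3 L).Adelic] [BorelSpace (G3 L).Adelic]

/-- **At the frozen family: `ThetaGPinnedHyp L v 𝔖 (𝔳.ΦGu S) (discreteSumG (G3 L) μG νG ∘ toAdelic) 0`'s body ↔ `θ_G(Φ_{u,φ}) = Σ_π m(π) Tr π(Φ_{u,φ})`** for all `(u, φ)`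
(D ED. 6′'s `hθ` binder, read without the vanishing summand). [cite: Rogawski1990, §13.6 (13.6.1) p. 208; §13.8 p. 218 L22–L28] -/
theorem thetaGPinned_frozen_zero_iff (𝔳 : S10Frozen L μ v νHv νQv mHv mQv πSt 𝔥) (S : Set (Pl L))
    (μG : Measure (G3 L).automorphicQuotient) [(G3 L).IsAutomorphicMeasure μG] (νG : Measure (G3 L).Adelic) [IsFiniteMeasureOnCompacts νG]
    {TH : Type*} (𝔖 : StabilisationData (GlobalTestFunction L 3 (qsForm L)) TH) :
    (∀ (u : UnrQs L S) (φ : Gqs L v → ℂ), 𝔖.θG (𝔳.ΦGu S u φ) =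
        (fun F : GlobalTestFunction L 3 (qsForm L) => discreteSumG (G3 L) μG νG (toAdelic F)) (𝔳.ΦGu S u φ) +
          (0 : GlobalTestFunction L 3 (qsForm L) → ℂ) (𝔳.ΦGu S u φ)) ↔
      ∀ (u : UnrQs L S) (φ : Gqs L v → ℂ), 𝔖.θG (𝔳.ΦGu S u φ) = discreteSumG (G3 L) μG νG (toAdelic (𝔳.ΦGu S u φ)) :=
  thetaGPinned_zero_iff 𝔖 (𝔳.ΦGu S) (fun F : GlobalTestFunction L 3 (qsForm L) => discreteSumG (G3 L) μG νG (toAdelic F))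

/-- **At the frozen family: (13.6.1) on all test functions + the intertwining term vanishing on the family ⇒ D's `hθ` body** at `dG := discreteSumG (G3 L) μG νG ∘ toAdelic`,
`contG := 0`. [cite: Rogawski1990, §13.6 (13.6.1) p. 208; §13.8 p. 218 L22–L28] [cite: Arthur2005IntroTraceFormula, §7 Thm. 7.2] -/
theorem thetaGPinned_frozen_zero_of_decomposition (𝔳 : S10Frozen L μ v νHv νQv mHv mQv πSt 𝔥) (S : Set (Pl L))
    (μG : Measure (G3 L).automorphicQuotient) [(G3 L).IsAutomorphicMeasure μG] (νG : Measure (G3 L).Adelic) [IsFiniteMeasureOnCompacts νG]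
    {TH : Type*} (𝔖 : StabilisationData (GlobalTestFunction L 3 (qsForm L)) TH) (contG : GlobalTestFunction L 3 (qsForm L) → ℂ)
    (hθ : ∀ F : GlobalTestFunction L 3 (qsForm L), 𝔖.θG F = discreteSumG (G3 L) μG νG (toAdelic F) + contG F)
    (hvan : ∀ (u : UnrQs L S) (φ : Gqs L v → ℂ), contG (𝔳.ΦGu S u φ) = 0) :
    ∀ (u : UnrQs L S) (φ : Gqs L v → ℂ), 𝔖.θG (𝔳.ΦGu S u φ) =
      (fun F : GlobalTestFunction L 3 (qsForm L) => discreteSumG (G3 L) μG νG (toAdelic F)) (𝔳.ΦGu S u φ) +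
        (0 : GlobalTestFunction L 3 (qsForm L) → ℂ) (𝔳.ΦGu S u φ) :=
  thetaGPinned_zero_of_decomposition 𝔖 (𝔳.ΦGu S) (fun F : GlobalTestFunction L 3 (qsForm L) => discreteSumG (G3 L) μG νG (toAdelic F)) contG hθ hvan

end Frozen

end Summit.HodgeConjecture.HodgeConjecture.R90.S10

end
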